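import Mathlib

/-!
# crux-ideate r2 ideator 4 — companion to `BarrierNotesIdeator4.md` §B20

The two-modulus reciprocity behind the normal form of the k-linear window phase:
for coprime `u, n ≥ 1`, with `a = (u⁻¹ mod n)` and `b = (n⁻¹ mod u)` (least residues),
`u·a + n·b ≡ 1 (mod u·n)`, i.e. `a/n + b/u ≡ 1/(u n) (mod 1)`.
Applied to `(u, n) = (dᵢ, D/dᵢ)` it gives `Eᵢ ≡ 1/D − Fᵢ` and hence
`e(ℓ n₀/D) = e(−ℓ(Σhᵢ)/D) · ∏ᵢ e(ℓ hᵢ · d̄ᵢ/(D/dᵢ))` (B20). No `sorry`.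
-/

namespace Summit.Parity.BatemanHorn.Cruxes.PolyMobiusTail.Ideator4

/-- `n ∣ u * (u⁻¹ mod n).val - 1` for `u` coprime to `n` (as integers). -/
theorem dvd_mul_invVal_sub_one (u n : ℕ) [NeZero n] (h : Nat.Coprime u n) :
    (n : ℤ) ∣ (u : ℤ) * (((u : ZMod n)⁻¹).val : ℤ) - 1 := by
  have h1 : ((u : ZMod n) * (((u : ZMod n)⁻¹).val : ZMod n)) = 1 := by
    rw [ZMod.natCast_zmod_val]
    exact ZMod.coe_mul_inv_eq_one u h
  have h2 : (((u : ℤ) * (((u : ZMod n)⁻¹).val : ℤ) : ℤ) : ZMod n) = ((1 : ℤ) : ZMod n) := by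
    push_cast
    exact_mod_cast h1
  rw [ZMod.intCast_eq_intCast_iff_dvd_sub] at h2
  -- h2 : (n:ℤ) ∣ 1 - u * val ; we want n ∣ u*val - 1
  have := h2
  rw [← Int.dvd_neg] at this
  simpa [neg_sub] using this

/-- The reciprocity congruence `u·(u⁻¹ mod n) + n·(n⁻¹ mod u) ≡ 1 (mod u·n)` for coprime moduli. -/
theorem reciprocity_congr (u n : ℕ) [NeZero u] [NeZero n] (h : Nat.Coprime u n) :
    ((u * n : ℕ) : ℤ) ∣ (u : ℤ) * (((u : ZMod n)⁻¹).val : ℤ) + (n : ℤ) * (((n : ZMod u)⁻¹).val : ℤ) - 1 := by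
  have hn := dvd_mul_invVal_sub_one u n h
  have hu := dvd_mul_invVal_sub_one n u h.symm
  set A : ℤ := (((u : ZMod n)⁻¹).val : ℤ) with hA
  set B : ℤ := (((n : ZMod u)⁻¹).val : ℤ) with hB
  -- n ∣ (uA - 1) + nB  and  u ∣ (nB - 1) + uA
  have hn' : (n : ℤ) ∣ (u : ℤ) * A + (n : ℤ) * B - 1 := by
    have : (u : ℤ) * A + (n : ℤ) * B - 1 = ((u : ℤ) * A - 1) + (n : ℤ) * B := by ring
    rw [this]
    exact dvd_add hn (dvd_mul_right _ _)
  have hu' : (u : ℤ) ∣ (u : ℤ) * A + (n : ℤ) * B - 1 := by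
    have : (u : ℤ) * A + (n : ℤ) * B - 1 = ((n : ℤ) * B - 1) + (u : ℤ) * A := by ring
    rw [this]
    exact dvd_add hu (dvd_mul_right _ _)
  have hcop : IsCoprime (u : ℤ) (n : ℤ) := Nat.isCoprime_iff_coprime.mpr h
  push_cast
  exact hcop.mul_dvd hu' hn'

/-- Rational form: `a/n + b/u - 1/(u n)` is an integer (the `(mod 1)` identity of B20). -/
theorem reciprocity_mod_one (u n : ℕ) [NeZero u] [NeZero n] (h : Nat.Coprime u n) :
    ∃ k : ℤ, ((((u : ZMod n)⁻¹).val : ℚ) / n + ((((n : ZMod u)⁻¹).val : ℚ)) / u - 1 / ((u : ℚ) * n)) = k := by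
  obtain ⟨k, hk⟩ := reciprocity_congr u n h
  refine ⟨k, ?_⟩
  have hu0 : (u : ℚ) ≠ 0 := by exact_mod_cast (NeZero.ne u)
  have hn0 : (n : ℚ) ≠ 0 := by exact_mod_cast (NeZero.ne n)
  have hk' : ((u : ℚ) * (((u : ZMod n)⁻¹).val : ℚ) + (n : ℚ) * (((n : ZMod u)⁻¹).val : ℚ) - 1)
      = ((u : ℚ) * n) * k := by
    have := congrArg (fun z : ℤ => (z : ℚ)) hk
    push_cast at this
    linarith [this]
  field_simp
  linarith [hk']

end Summit.Parity.BatemanHorn.Cruxes.PolyMobiusTail.Ideator4
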